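import Mathlib
import Summits.CriticalPhenomena.PercolationContinuityZ3.Theorems.PercNearOneGluingNearOneGluingAttachSetRescueNegCorr
import Summits.CriticalPhenomena.PercolationContinuityZ3.Theorems.PercNearOneGluingNearOneGluingAttachAloneRescueBound
import Summits.CriticalPhenomena.PercolationContinuityZ3.Theorems.PercNearOneGluingAdditiveGluingBhkSetsAux
import Literature.Probability.Percolation.SharpnessDCTProofs
import Literature.Probability.LatticeModels.ProdBernoulliIndependence
import Literature.Probability.Percolation.Crossings
import Literature.Probability.Percolation.PercolationEvents
import HarnessLib

/-!
# Crux `PercNearOneGluing.NearOneGluing` (stmt-CriticalPhenomena-4574), line `SketchR2I5` — stub `stub_attachAloneSetRescueBound`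

Helper file for the crux (lead prover-line-stmt-CriticalPhenomena-4574-c5): the SET version of
the correlation lemma `stub_attachAloneRescueBound` (the BHK half of the `g′`-term of the `|A| = 3`
kernel of RESCUE).  Proves exactly the registered stub signature; lands with
`--supports stmt-CriticalPhenomena-4574`.

## Content

Finite weighted graph on `Fin n`, `μ = prodBernoulli w` on bond configurations
`ω : Set (Sym2 (Fin n))`, source `o`, target `b`, an outsider `x`, a relay SET `A : Finset (Fin n)`
and vertex sets `S, S₁`.  Events: `X = {o ↔ x inside S₁}` (the outsider is attached),
`F_A = {∃ a ∈ A, o ↔ a inside insert a S}` (the set is attached), `D = {∀ a ∈ A, x ↮ a}` (the outsider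
is not joined to the set), `L = ⋃ a ∈ A, {a ↔ b}` (the set is alive) and
`g′ = (L ∩ {x ↮ b}) ∩ D` ("the set is alive, the outsider is dead and not joined to the set").
THEOREM (`stub_attachAloneSetRescueBound`):
**`μ(D) · μ((X ∖ F_A) ∩ g′) ≤ μ((X ∖ F_A) ∩ D) · μ(g′)`.**

Proof (the proof of `stub_attachAloneRescueBound` transported to the hub-augmented graph of the
file `PercNearOneGluingAdditiveGluingBhkSetsAux`).  On `Option (Fin n)` (hub `none`, old vertex `v`
as `some v`) put the augmented weights `hubW⟦A, w⟧` (old pairs keep their weight, the hub pairs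
`s(none, some a)`, `a ∈ A`, get weight `1`, all other new pairs weight `0`); the law of the lift
`hubLift⟦A, η⟧` under `μ` is `prodBernoulli hubW⟦A, w⟧` (`bhkHub_integral`), so
`μ'(E) = μ(lift ⁻¹' E)` for every event `E` of the augmented graph (`attachSet_measureReal_hub`).
van den Berg–Häggström–Kahn (2006), Thm. 1.5 on the augmented graph for the pair
`(s, t) = (some x, none)` (`attachAloneRescueBound_twoCluster`) with
`P = {some o ↔ some x inside some '' S₁}` (increasing in `C_{some x}`) and the increasing event
`Q' = {∃ a ∈ A, s(none, some a) open ∧ some o ↔ some a inside some '' (insert a S)}` (increasing in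
the open edge cluster of the hub, `attachSet_hubEvent_mono_openEdgeCluster`) pulls back to
`μ(D ∩ (X ∖ F_A)) · μ(D ∩ Lᶜ) ≤ μ(D) · μ(D ∩ (X ∖ F_A) ∩ Lᶜ)`
(pull-backs: `{some x ↮ none} ↦ D`, `P ↦ X`, `Q' ↦ F_A`, `{none ↮ some b} ↦ Lᶜ`).  Passing to
complements inside `D` gives `μ(D) · μ(D ∩ (X ∖ F_A) ∩ L) ≤ μ(D ∩ (X ∖ F_A)) · μ(D ∩ L)`, and
`g′ = D ∩ L` (on `D`, `a ↔ b` for some `a ∈ A` forces `x ↮ b`).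
-/

namespace Summit.CriticalPhenomena.PercolationContinuityZ3.Theorems

open MeasureTheory Set Literature.Probability.LatticeModels Literature.Probability.Percolation
open scoped Classical BigOperators

section AttachAloneSetRescueBound

variable {V : Type*}

/-- `hubLift⟦A, η⟧`, the hub lift of a configuration `η` on `V` to the augmented vertex type
`Option V` (file-local notation for the tree term `Sym2.map some '' η ∪ {e | ∃ a ∈ A, e = s(none, some a)}`,
copied from `PercNearOneGluingAdditiveGluingBhkSetsAux`). -/
local notation3 (prettyPrint := false) "hubLift⟦" A ", " η "⟧" =>
  (Sym2.map some '' η ∪ {e | ∃ a ∈ A, e = s(none, some a)})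

/-- `hubW⟦A, w⟧`, the augmented weights (file-local notation for the tree term
`Function.extend (Sym2.map some) w (fun e => if ∃ a ∈ A, e = s(none, some a) then 1 else 0)`, copied
from `PercNearOneGluingAdditiveGluingBhkSetsAux`). -/
local notation3 (prettyPrint := false) "hubW⟦" A ", " w "⟧" =>
  (Function.extend (Sym2.map some) w fun e =>
    @ite unitInterval (∃ a ∈ A, e = s(none, some a)) (Classical.dec _) 1 0)

/-! ### Pull-backs of the events of the augmented graph under the lift -/

/-- **Pull-back of `{none ↮ some b}`**: the set is dead, `(⋃ a ∈ A, {a ↔ b})ᶜ`. -/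
theorem attachAloneSet_pull_dead {A : Finset V} {b : V} (η : BondConfig V) :
    hubLift⟦A, η⟧ ∈ (openConn none (some b) : Set (BondConfig (Option V)))ᶜ ↔
      η ∈ (⋃ a ∈ A, (openConn a b : Set (BondConfig V)))ᶜ := by
  rw [Set.mem_compl_iff, attachSet_lift_mem_openConn_none_some, Set.mem_compl_iff, Set.mem_iUnion₂]
  exact not_congr (exists_congr fun _ => exists_prop.symm)

/-- **Pull-back of `P ∖ Q'`** (`P = {some o ↔ some x inside some '' S₁}`, `Q'` the attachment
event of the augmented graph): `X ∖ F_A`. -/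
theorem attachAloneSet_pull_PQ {A : Finset V} {S S₁ : Set V} {o x : V} (η : BondConfig V) :
    hubLift⟦A, η⟧ ∈ (openConnIn (some '' S₁) (some o) (some x) : Set (BondConfig (Option V))) \
        {ω : BondConfig (Option V) | ∃ a ∈ A, s(none, some a) ∈ ω ∧
          ω ∈ openConnIn (some '' insert a S) (some o) (some a)} ↔
      η ∈ (openConnIn S₁ o x : Set (BondConfig V)) \
        {ω : BondConfig V | ∃ a ∈ A, ω ∈ openConnIn (insert a S) o a} :=
  and_congr attachSet_lift_mem_openConnIn (not_congr attachSet_lift_mem_hubEvent)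

/-- **Pull-back of `D' ∩ (P ∖ Q')`**: `D ∩ (X ∖ F_A)`. -/
theorem attachAloneSet_pull_DPQ {A : Finset V} {S S₁ : Set V} {o x : V} (η : BondConfig V) :
    hubLift⟦A, η⟧ ∈ (openConn (some x) none : Set (BondConfig (Option V)))ᶜ ∩
        ((openConnIn (some '' S₁) (some o) (some x) : Set (BondConfig (Option V))) \
          {ω : BondConfig (Option V) | ∃ a ∈ A, s(none, some a) ∈ ω ∧
            ω ∈ openConnIn (some '' insert a S) (some o) (some a)}) ↔
      η ∈ {ω : BondConfig V | ∀ a ∈ A, ω ∉ (openConn x a : Set (BondConfig V))} ∩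
        ((openConnIn S₁ o x : Set (BondConfig V)) \
          {ω : BondConfig V | ∃ a ∈ A, ω ∈ openConnIn (insert a S) o a}) :=
  and_congr (attachSet_pull_D η) (attachAloneSet_pull_PQ η)

/-- **Pull-back of `D' ∩ {none ↮ some b}`**: `D ∩ Lᶜ`. -/
theorem attachAloneSet_pull_Ddead {A : Finset V} {x b : V} (η : BondConfig V) :
    hubLift⟦A, η⟧ ∈ (openConn (some x) none : Set (BondConfig (Option V)))ᶜ ∩
        (openConn none (some b) : Set (BondConfig (Option V)))ᶜ ↔
      η ∈ {ω : BondConfig V | ∀ a ∈ A, ω ∉ (openConn x a : Set (BondConfig V))} ∩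
        (⋃ a ∈ A, (openConn a b : Set (BondConfig V)))ᶜ :=
  and_congr (attachSet_pull_D η) (attachAloneSet_pull_dead η)

/-- **Pull-back of `D' ∩ ((P ∖ Q') ∩ {none ↮ some b})`**: `D ∩ ((X ∖ F_A) ∩ Lᶜ)`. -/
theorem attachAloneSet_pull_DPQdead {A : Finset V} {S S₁ : Set V} {o x b : V} (η : BondConfig V) :
    hubLift⟦A, η⟧ ∈ (openConn (some x) none : Set (BondConfig (Option V)))ᶜ ∩
        ((openConnIn (some '' S₁) (some o) (some x) : Set (BondConfig (Option V))) \
          {ω : BondConfig (Option V) | ∃ a ∈ A, s(none, some a) ∈ ω ∧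
            ω ∈ openConnIn (some '' insert a S) (some o) (some a)} ∩
          (openConn none (some b) : Set (BondConfig (Option V)))ᶜ) ↔
      η ∈ {ω : BondConfig V | ∀ a ∈ A, ω ∉ (openConn x a : Set (BondConfig V))} ∩
        ((openConnIn S₁ o x : Set (BondConfig V)) \
          {ω : BondConfig V | ∃ a ∈ A, ω ∈ openConnIn (insert a S) o a} ∩
          (⋃ a ∈ A, (openConn a b : Set (BondConfig V)))ᶜ) :=
  and_congr (attachSet_pull_D η) (and_congr (attachAloneSet_pull_PQ η) (attachAloneSet_pull_dead η))

/-! ### The stub -/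

/-- **The piece "outsider attached, relay SET not" is nonpositively correlated with "the set is
alive and the outsider is dead", given that the outsider is not joined to the set.**  With
`X := openConnIn S₁ o x`, `F_A := {∃ a ∈ A, o ↔ a inside insert a S}`, `D := {∀ a ∈ A, x ↮ a}` and
`g′ := ((⋃ a ∈ A, {a ↔ b}) ∩ {x ↮ b}) ∩ D`:
`μ(D) · μ((X ∖ F_A) ∩ g′) ≤ μ((X ∖ F_A) ∩ D) · μ(g′)`.
From van den Berg–Häggström–Kahn (2006) Thm. 1.5 on the hub-augmented graph for the pair
`(some x, none)` (`attachAloneRescueBound_twoCluster`, `bhkHub_integral`) and the set identity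
`g′ = D ∩ ⋃ a ∈ A, {a ↔ b}`. [cite: VandenbergHaggstromKahn2005, Thm. 1.5 (p. 7)] -/
theorem stub_attachAloneSetRescueBound :
    ∀ (n : ℕ) (w : Sym2 (Fin n) → unitInterval) (A : Finset (Fin n)) (S S₁ : Set (Fin n)) (o b x : Fin n),
      (prodBernoulli w).real {ω | ∀ a ∈ A, ω ∉ openConn x a} *
          (prodBernoulli w).real ((openConnIn S₁ o x \ {ω | ∃ a ∈ A, ω ∈ openConnIn (insert a S) o a}) ∩
            (((⋃ a ∈ A, openConn a b) ∩ (openConn x b)ᶜ) ∩ {ω | ∀ a ∈ A, ω ∉ openConn x a})) ≤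
        (prodBernoulli w).real ((openConnIn S₁ o x \ {ω | ∃ a ∈ A, ω ∈ openConnIn (insert a S) o a}) ∩
            {ω | ∀ a ∈ A, ω ∉ openConn x a}) *
          (prodBernoulli w).real (((⋃ a ∈ A, openConn a b) ∩ (openConn x b)ᶜ) ∩ {ω | ∀ a ∈ A, ω ∉ openConn x a}) := by
  intro n w A S S₁ o b x
  have hm : ∀ E : Set (BondConfig (Fin n)), MeasurableSet E := fun _ => MeasurableSet.of_discrete
  -- `g′ = D ∩ L`: on `D`, `a ↔ b` for some `a ∈ A` forces `x ↮ b`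
  have hg : (((⋃ a ∈ A, openConn a b) ∩ (openConn x b)ᶜ) ∩ {ω | ∀ a ∈ A, ω ∉ openConn x a} :
      Set (BondConfig (Fin n))) =
      {ω | ∀ a ∈ A, ω ∉ openConn x a} ∩ ⋃ a ∈ A, openConn a b := by
    ext ω
    constructor
    · rintro ⟨⟨h1, -⟩, h3⟩
      exact ⟨h3, h1⟩
    · rintro ⟨h3, h1⟩
      refine ⟨⟨h1, fun h2 => ?_⟩, h3⟩
      obtain ⟨a, ha, hab⟩ := Set.mem_iUnion₂.1 h1
      exact h3 a ha (SimpleGraph.Reachable.trans h2 (SimpleGraph.Reachable.symm hab))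
  -- BHK Thm. 1.5 on the hub-augmented graph for `(s, t) = (some x, none)`, pulled back to `μ`
  have key := attachAloneRescueBound_twoCluster (V := Option (Fin n)) hubW⟦A, w⟧ (some x) none (some b)
    (openConnIn (some '' S₁) (some o) (some x))
    {ω : BondConfig (Option (Fin n)) | ∃ a ∈ A, s(none, some a) ∈ ω ∧
      ω ∈ openConnIn (some '' insert a S) (some o) (some a)}
    (maxattTwo_openConnIn_mono_openEdgeCluster (some '' S₁) (some o) (some x))
    (attachSet_hubEvent_mono_openEdgeCluster A S o) (Option.some_ne_none x)
  rw [attachSet_measureReal_hub A w (attachAloneSet_pull_DPQ (A := A) (S := S) (S₁ := S₁) (o := o) (x := x)),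
    attachSet_measureReal_hub A w (attachAloneSet_pull_Ddead (A := A) (x := x) (b := b)),
    attachSet_measureReal_hub A w (attachSet_pull_D (A := A) (x := x)),
    attachSet_measureReal_hub A w
      (attachAloneSet_pull_DPQdead (A := A) (S := S) (S₁ := S₁) (o := o) (x := x) (b := b))] at key
  -- notation
  set μ := prodBernoulli w with hμ
  set R : Set (BondConfig (Fin n)) :=
    openConnIn S₁ o x \ {ω | ∃ a ∈ A, ω ∈ openConnIn (insert a S) o a} with hR
  set D : Set (BondConfig (Fin n)) := {ω | ∀ a ∈ A, ω ∉ openConn x a} with hD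
  set L : Set (BondConfig (Fin n)) := ⋃ a ∈ A, openConn a b with hL
  -- complements inside `D`
  have hsplit : ∀ X Y : Set (BondConfig (Fin n)), μ.real (X ∩ Yᶜ) = μ.real X - μ.real (X ∩ Y) := by
    intro X Y
    have h := measureReal_inter_add_sdiff (μ := μ) (s := X) (t := Y) (hm Y)
    rw [Set.sdiff_eq_compl_inter, Set.inter_comm Yᶜ X] at h
    linarith
  rw [show D ∩ (R ∩ Lᶜ) = (D ∩ R) ∩ Lᶜ from (Set.inter_assoc _ _ _).symm,
    hsplit D L, hsplit (D ∩ R) L] at key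
  -- `key : μ (D ∩ R) * (μ D - μ (D ∩ L)) ≤ μ D * (μ (D ∩ R) - μ (D ∩ R ∩ L))`
  rw [hg, show R ∩ (D ∩ L) = D ∩ R ∩ L by rw [← Set.inter_assoc, Set.inter_comm R D],
    Set.inter_comm R D]
  nlinarith [key]

end AttachAloneSetRescueBound

end Summit.CriticalPhenomena.PercolationContinuityZ3.Theorems
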